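import Mathlib
import Literature.MathematicalPhysics.QuantumFieldTheory.Balaban1983to89.B10LogDet63
import Literature.LinearAlgebra.Matrix.HermitianCfcDiagonalForm

/-!
# `Balaban1983to89.B10Eq63Contour` — [Balaban1985UV3] (63) pp. 271–272: the CONTOUR members of the
# log-determinant display — the keyhole contour `C`, `−½ Tr log T = −(1/4πi)∮_C dz log z Tr(zI − T)⁻¹`,
# the circle integrals `∮_{|z|=2γ₁} dz log z z^{−n−1}` and (63) line 1, kernel-checked

statement-level skeleton of published theorems with citation tags; proofs where landed; nothing here is a claim
about the Yang–Mills mass gap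

T. Bałaban, *Ultraviolet stability of three-dimensional lattice pure gauge field theories*, Commun. Math. Phys. **102**,
255–275 (1985), doi:10.1007/bf01229380 [Balaban1985UV3] (cell paper B10).  PDF held:
`paper:balaban1985-cmp102-uv-stability-3d` (journal page = PDF page + 254; the displays below were read from the page
renders `…-p017-x2.png` (p. 271) and `…-p018-x2.png` (p. 272), READ AS IMAGES).

WHAT IS REPRODUCED = SKELETON row `B10.Eq63` (HOME `run/shared/lean/pub/lit-balaban/`, unit `lit-balaban-r07`), the
members of the display that the tree's operator-level certificate `…B10LogDet63.matrix63` does NOT reproduce.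
p. 271 [PDF 17], verbatim: *"We consider the Gaussian integral now. Its logarithm is equal to a sum of an absolute
constant, cancelled by the same constant from the second term in (61), and the expression*
`½ log det(C*Δ_kC)⁻¹ = −½ Tr log(C*Δ_kC) = −(1/4πi)∮_C dz log z Tr(zI − C*Δ_kC)⁻¹`, *where the contour C is a union
of the circle |z| = γ₁* ⟦sic; `2γ₁`, as in (63)⟧*, and the two intervals [2γ₁, 0]* ⟦sic; `[−2γ₁, 0]`, the cut of
`log`⟧ *with opposite orientations. The number γ₁ is an upper bound of the positive, bounded operator C*Δ_kC. Hence
the integral above can be written as a sum of two integrals, and we have*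
`½ log det(C*Δ_kC)⁻¹ = ½∫₀^{2γ₁} dx Tr(C*Δ_kC + xI)⁻¹ − Σ_{n=0}^∞ (1/4πi)∮_{|z|=2γ₁} dz log z (1/z^{n+1})(C*Δ_kC)ⁿ`
`= ½∫₀^{2γ₁} dx Tr(C*Δ_kC + xI)⁻¹ − ½C*Δ_kC` ⟦sic; `−½ log(2γ₁)·Tr I`⟧ `+ Σ_{n=1}^∞ ((−1)ⁿ/2n)(2γ₁)⁻ⁿ(C*Δ_kC)ⁿ`
⟦a `Tr` is missing in the last two members⟧ (63)" (p. 272 [PDF 18]).  The misprint readings are the cell's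
(`…B10.logdet63_skeleton`, `…B10LogDet63` §0, DIVERGENCE D-adv2-1 / D-b10.2) and are CONFIRMED here term by term.

WHAT IS KERNEL-CERTIFIED (finite-dimensional model: a positive definite real symmetric matrix `T` on a finite index
type — *"the positive, bounded operator C*Δ_kC"* — with every eigenvalue `≤ γ₁`; `log` = Mathlib's principal
branch `Complex.log`, cut along the negative real axis; circles = Mathlib's `circleIntegral`):
* §1 the circle integrals of (63) line 1: `∮_{|z|=R} dz log z · z^{−(n+1)} = −2πi(−1)ⁿ/(nRⁿ)` for `n ≥ 1` and
  `= 2πi log R` for `n = 0` (`circleIntegral_inv_pow_mul_log`, `circleIntegral_inv_mul_log`); hence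
  `−(1/4πi)·(that)·Tr Tⁿ` is `((−1)ⁿ/2n)R⁻ⁿ Tr Tⁿ` resp. `−½ log R · Tr I` — the printed passage from line 1 to
  line 2 of (63), including the reading of its middle term;
* §2 the Cauchy integral of the (discontinuous but circle-integrable) boundary function `log` over the circle:
  `∮_{|z|=R} dz log z/(z − w) = 2πi log(R + w)` for `|w| < R` (`circleIntegral_sub_inv_mul_log`; Mathlib's
  `hasSum_two_pi_I_cauchyPowerSeries_integral` + §1 + the logarithmic series);
* §3 the keyhole contour `C` = circle `|z| = R` ∪ the two edges of the cut `[−R, 0]` with opposite orientations: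
  the edge integrals carry the two boundary values `log x ± iπ` of `log z` at `z = −x` (the upper one IS the principal
  value `Complex.log (−x)`, the lower one is its limit from `Im z < 0`, Mathlib's
  `Complex.tendsto_log_nhdsWithin_im_neg_of_re_neg_of_im_zero` — `lower_boundary_value`); their sum is
  `2πi∫₀^R g(−x)dx` (`cutUpper_add_cutLower`) — *"the integral above can be written as a sum of two integrals"*;
* §4 one eigenvalue `0 < λ < R`: `∮_C dz log z (z − λ)⁻¹ = 2πi log λ`, i.e. `−(1/4πi)∮_C dz log z (z − λ)⁻¹ =
  −½ log λ = ½ log λ⁻¹` (`keyhole_sub_inv`, `scalar63_contour`);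
* §5 operator level: `Tr(zI − T)⁻¹ = Σ_k (z − λ_k)⁻¹` for the complexified real symmetric `T` off its spectrum
  (`trace_resolvent_complexify`), and for `T ≻ 0` with eigenvalues `≤ γ₁`, `R = 2γ₁`:
  `½ log det T⁻¹ = −½ Tr log T = −(1/4πi)∮_C dz log z Tr(zI − T)⁻¹` (`matrix63_contour`, `matrix63_members`), the
  termwise expansion of the circle part `∮_{|z|=2γ₁} dz log z Tr(zI − T)⁻¹ = Σ_{n≥0} (∮ dz log z z^{−n−1}) Tr Tⁿ`
  (`hasSum_circle_expansion`) — (63) line 1 — and its evaluation reproducing (63) line 2 = the right-hand side of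
  `…B10LogDet63.matrix63` (`matrix63_line1`, `matrix63_line1_eq_line2`).

WHAT IS NOT CERTIFIED OR ASSERTED: anything about the operator `C*Δ_kC` of the paper beyond "finite-dimensional,
positive, bounded by γ₁" (its construction, [5] Sect. E, the elimination `A = CÃ`, the bound `γ₁` — cell GAPS C-IF-07);
the random-walk expansions of the three pieces of (63) (p. 272; hypothesis leaves `…B10LogDet63.G3WalkBound`,
`…B10Eq63Rep.G3Rep/G3Cont`, GAPS G-B10-06); the local terms `−log det S(V_k^{(k)}, b₀(c))` of p. 271.  Every certified
declaration is finite-dimensional spectral calculus + one-variable complex analysis; value = kernel certificate of the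
printed contour calculus, NOT summit progress.  No `sorry`, no new axiom, no named unproved fact (no `def … : Prop`); the
four `def`s are definitions with bodies (the two edge integrals and the keyhole contour integral of §3, the contour
integrand `resolventTrace` of §5).  Unit `lit-balaban-r07` (B10 fold owner), gen 4; scratch non-vacuity checks (keyhole
at `λ = 1, R = 2`; the identity matrix on `Fin 3`; the circle integrals at `R = 1`) in the unit folder, not shipped.

## References
* [Balaban1985UV3] T. Bałaban, Commun. Math. Phys. 102 (1985) 255–275, (63) pp. 271–272.
* [Balaban1985BackgroundPropagators] T. Bałaban, Commun. Math. Phys. 99 (1985) 389–434 (= [5] of the paper), Sect. E.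
-/

noncomputable section

open MeasureTheory Set Filter Matrix Finset Complex
open scoped Real Topology

namespace Literature.MathematicalPhysics.QuantumFieldTheory.Balaban1983to89.B10Eq63Contour

open Literature.MathematicalPhysics.QuantumFieldTheory.Balaban1983to89

/-! ## §1. The circle integrals `∮_{|z|=R} dz log z · z^{−(n+1)}` of (63) line 1 -/

section circle

/-- On the principal branch, `log(R e^{iθ}) = log R + iθ` for `R > 0`, `θ ∈ (−π, π]`. [folklore] -/
private theorem log_circleMap {R : ℝ} (hR : 0 < R) {θ : ℝ} (hθ : θ ∈ Set.Ioc (-π) π) :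
    Complex.log (circleMap 0 R θ) = Real.log R + θ * I := by
  rw [circleMap_zero, Complex.log_ofReal_mul hR (Complex.exp_ne_zero _), Complex.log_exp]
  · simpa using hθ.1
  · simpa using hθ.2

/-- The circle-integral integrand `θ ↦ (d/dθ)(R e^{iθ}) · f(R e^{iθ})` is `2π`-periodic. [folklore] -/
private theorem periodic_integrand (f : ℂ → ℂ) (R : ℝ) :
    Function.Periodic (fun θ : ℝ => deriv (circleMap 0 R) θ • f (circleMap 0 R θ)) (2 * π) := by
  intro θ
  simp only [deriv_circleMap, periodic_circleMap 0 R θ]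

/-- `∮_{|z|=R} f = ∫_{−π}^{π} (d/dθ)(R e^{iθ}) f(R e^{iθ}) dθ` (the parameter interval shifted to `(−π, π]`, where the
principal `log` of the circle point is `log R + iθ`). [folklore] -/
private theorem circleIntegral_eq_integral_Ioc (f : ℂ → ℂ) (R : ℝ) :
    (∮ z in C(0, R), f z) = ∫ θ in (-π)..π, deriv (circleMap 0 R) θ • f (circleMap 0 R θ) := by
  rw [circleIntegral]
  have h := (periodic_integrand f R).intervalIntegral_add_eq 0 (-π)
  simp only [zero_add] at h
  rw [h]
  congr 1
  ring

/-- The integrand of `∮_{|z|=R} dz log z · z^{−(n+1)}` on `(−π, π]`: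
`iR^{−n} e^{−inθ}(log R + iθ)`. [folklore] -/
private theorem integrand_inv_pow_mul_log {R : ℝ} (hR : 0 < R) (n : ℕ) {θ : ℝ} (hθ : θ ∈ Set.Ioc (-π) π) :
    deriv (circleMap 0 R) θ • ((circleMap 0 R θ ^ (n + 1))⁻¹ * Complex.log (circleMap 0 R θ))
      = I * ((R : ℂ) ^ n)⁻¹ * Complex.exp (-(n * θ * I)) * (Real.log R + θ * I) := by
  rw [log_circleMap hR hθ, deriv_circleMap, smul_eq_mul, circleMap_zero]
  have hR' : (R : ℂ) ≠ 0 := ofReal_ne_zero.mpr hR.ne'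
  have hE : Complex.exp (θ * I) ≠ 0 := Complex.exp_ne_zero _
  have hexp : Complex.exp (-(n * θ * I)) = (Complex.exp (θ * I) ^ n)⁻¹ := by
    rw [← Complex.exp_nat_mul, ← Complex.exp_neg]; ring_nf
  rw [hexp]
  field_simp
  ring

/-- `e^{−inπ} = (−1)ⁿ`. [folklore] -/
private theorem cexp_neg_nat_mul_pi_mul_I (n : ℕ) : Complex.exp (-(n * π * I)) = (-1) ^ n := by
  rw [Complex.exp_neg, show (n : ℂ) * π * I = n * (π * I) by ring, Complex.exp_nat_mul, Complex.exp_pi_mul_I,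
    ← inv_pow]
  norm_num

/-- `e^{inπ} = (−1)ⁿ`. [folklore] -/
private theorem cexp_nat_mul_pi_mul_I (n : ℕ) : Complex.exp (n * π * I) = (-1) ^ n := by
  rw [show (n : ℂ) * π * I = n * (π * I) by ring, Complex.exp_nat_mul, Complex.exp_pi_mul_I]

/-- An antiderivative of `θ ↦ iR^{−n}e^{−inθ}(log R + iθ)` for `n ≠ 0`:
`Φ(θ) = iR^{−n}e^{−inθ}(i log R/n − θ/n + i/n²)`. [folklore] -/
private theorem hasDerivAt_antideriv (R : ℝ) {n : ℕ} (hn : n ≠ 0) (θ : ℝ) :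
    HasDerivAt (fun θ : ℝ => I * ((R : ℂ) ^ n)⁻¹ * Complex.exp (-(n * θ * I))
        * (I * Real.log R / n - θ / n + I / (n : ℂ) ^ 2))
      (I * ((R : ℂ) ^ n)⁻¹ * Complex.exp (-(n * θ * I)) * (Real.log R + θ * I)) θ := by
  have hn' : (n : ℂ) ≠ 0 := Nat.cast_ne_zero.mpr hn
  have h1 : HasDerivAt (fun z : ℂ => -(n * z * I)) (-(n * I)) (θ : ℂ) := by
    have h := (((hasDerivAt_id (θ : ℂ)).const_mul (n : ℂ)).mul_const I).fun_neg
    simpa only [id_eq, mul_one] using h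
  have h2 : HasDerivAt (fun z : ℂ => Complex.exp (-(n * z * I)))
      (Complex.exp (-(n * θ * I)) * -(n * I)) (θ : ℂ) :=
    (Complex.hasDerivAt_exp _).comp (θ : ℂ) h1
  have h3 : HasDerivAt (fun z : ℂ => I * Real.log R / n - z / n + I / (n : ℂ) ^ 2) (-(1 / n)) (θ : ℂ) := by
    have h := (((hasDerivAt_id (θ : ℂ)).div_const (n : ℂ)).const_sub (I * Real.log R / n)).add_const
      (I / (n : ℂ) ^ 2)
    simp only [id_eq] at h
    convert h using 1
  have h4 := ((h2.fun_mul h3).const_mul (I * ((R : ℂ) ^ n)⁻¹)).comp_ofReal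
  have hI : I * I = -1 := Complex.I_mul_I
  have hu : (n : ℂ) * (n : ℂ)⁻¹ = 1 := mul_inv_cancel₀ hn'
  convert h4 using 1
  · funext y
    ring
  · linear_combination (I * (((R : ℂ) ^ n)⁻¹ * Complex.exp (-(n * θ * I))) * ((Real.log R : ℂ) + (n : ℂ)⁻¹)) * hI
      + (I * (((R : ℂ) ^ n)⁻¹ * Complex.exp (-(n * θ * I)))
          * (I * I * (Real.log R : ℂ) - I * θ + I * I * (n : ℂ)⁻¹)) * hu

/-- An antiderivative of `θ ↦ i(log R + iθ) = i log R − θ` (the case `n = 0`). [folklore] -/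
private theorem hasDerivAt_antideriv_zero (R : ℝ) (θ : ℝ) :
    HasDerivAt (fun θ : ℝ => I * Real.log R * θ - (θ : ℂ) ^ 2 / 2)
      (I * ((R : ℂ) ^ 0)⁻¹ * Complex.exp (-((0 : ℕ) * θ * I)) * (Real.log R + θ * I)) θ := by
  have ha := (hasDerivAt_id (θ : ℂ)).const_mul (I * Real.log R)
  have hb := ((hasDerivAt_pow 2 (θ : ℂ))).div_const (2 : ℂ)
  have h2 := (ha.fun_sub hb).comp_ofReal
  simp only [id_eq] at h2
  have hI : I * I = -1 := Complex.I_mul_I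
  convert h2 using 1
  simp only [Nat.cast_zero, zero_mul, neg_zero, Complex.exp_zero, pow_zero, inv_one, mul_one, Nat.cast_ofNat,
    pow_one, Nat.add_one_sub_one]
  linear_combination (θ : ℂ) * hI

/-- **The circle integrals of (63), `n ≥ 1`**: `∮_{|z|=R} dz log z · z^{−(n+1)} = −2πi(−1)ⁿ/(nRⁿ)` (principal
`log`; the jump of `log` across the cut at `z = −R` is what makes these non-zero).  Consequently
`−(1/4πi)·(∮ dz log z z^{−n−1})·Tr Tⁿ = ((−1)ⁿ/2n)R⁻ⁿ Tr Tⁿ`, the n-th term of (63) line 2 with `R = 2γ₁`.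
[cite: Balaban1985UV3, (63) p.272] -/
theorem circleIntegral_inv_pow_mul_log {R : ℝ} (hR : 0 < R) {n : ℕ} (hn : n ≠ 0) :
    (∮ z in C(0, R), (z ^ (n + 1))⁻¹ * Complex.log z) = -(2 * π * I) * (-1) ^ n / (n * (R : ℂ) ^ n) := by
  rw [circleIntegral_eq_integral_Ioc]
  have hcongr : ∫ θ in (-π)..π, deriv (circleMap 0 R) θ •
      ((circleMap 0 R θ ^ (n + 1))⁻¹ * Complex.log (circleMap 0 R θ))
      = ∫ θ in (-π)..π, I * ((R : ℂ) ^ n)⁻¹ * Complex.exp (-(n * θ * I)) * (Real.log R + θ * I) := by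
    refine intervalIntegral.integral_congr_ae (ae_of_all _ fun θ hθ => ?_)
    rw [uIoc_of_le (by linarith [Real.pi_pos])] at hθ
    exact integrand_inv_pow_mul_log hR n hθ
  rw [hcongr, intervalIntegral.integral_eq_sub_of_hasDerivAt (fun θ _ => hasDerivAt_antideriv R hn θ)
    (Continuous.intervalIntegrable (by fun_prop) _ _)]
  have hn' : (n : ℂ) ≠ 0 := Nat.cast_ne_zero.mpr hn
  have hR' : (R : ℂ) ≠ 0 := ofReal_ne_zero.mpr hR.ne'
  have e1 : Complex.exp (-(n * (π : ℝ) * I)) = (-1) ^ n := cexp_neg_nat_mul_pi_mul_I n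
  have e2 : Complex.exp (-(n * ((-π : ℝ) : ℂ) * I)) = (-1) ^ n := by
    rw [show -(n * ((-π : ℝ) : ℂ) * I) = n * π * I by push_cast; ring]
    exact cexp_nat_mul_pi_mul_I n
  rw [e1, e2]
  push_cast
  field_simp
  ring

/-- **The circle integral of (63), `n = 0`**: `∮_{|z|=R} dz log z · z⁻¹ = 2πi log R`.  Consequently
`−(1/4πi)·(∮ dz log z z⁻¹)·Tr I = −½ log R · Tr I`, the reading of the middle term of (63) line 2 ⟦printed
`−½C*Δ_kC`⟧ with `R = 2γ₁`. [cite: Balaban1985UV3, (63) p.272] -/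
theorem circleIntegral_inv_mul_log {R : ℝ} (hR : 0 < R) :
    (∮ z in C(0, R), z⁻¹ * Complex.log z) = 2 * π * I * Real.log R := by
  rw [circleIntegral_eq_integral_Ioc]
  have hcongr : ∫ θ in (-π)..π, deriv (circleMap 0 R) θ • ((circleMap 0 R θ)⁻¹ * Complex.log (circleMap 0 R θ))
      = ∫ θ in (-π)..π, I * ((R : ℂ) ^ 0)⁻¹ * Complex.exp (-((0 : ℕ) * θ * I)) * (Real.log R + θ * I) := by
    refine intervalIntegral.integral_congr_ae (ae_of_all _ fun θ hθ => ?_)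
    rw [uIoc_of_le (by linarith [Real.pi_pos])] at hθ
    have := integrand_inv_pow_mul_log hR 0 hθ
    simpa only [zero_add, pow_one] using this
  rw [hcongr, intervalIntegral.integral_eq_sub_of_hasDerivAt (fun θ _ => hasDerivAt_antideriv_zero R θ)
    (Continuous.intervalIntegrable (by fun_prop) _ _)]
  push_cast
  ring

end circle

/-! ## §2. The Cauchy integral of the boundary function `log` over the circle -/

section cauchy

/-- The principal `log` is circle integrable on `|z| = R`, `R > 0` (it is bounded and continuous except at `z = −R`).
[folklore] -/
private theorem circleIntegrable_log {R : ℝ} (hR : 0 < R) : CircleIntegrable Complex.log 0 R := by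
  have hper : Function.Periodic (fun θ : ℝ => Complex.log (circleMap 0 R θ)) (2 * π) :=
    fun θ => by simp only [periodic_circleMap 0 R θ]
  have h1 : IntervalIntegrable (fun θ : ℝ => Complex.log (circleMap 0 R θ)) volume (-π) (-π + 2 * π) := by
    have hc : IntervalIntegrable (fun θ : ℝ => (Real.log R : ℂ) + θ * I) volume (-π) (-π + 2 * π) :=
      Continuous.intervalIntegrable (by fun_prop) _ _
    refine (intervalIntegrable_congr fun θ hθ => ?_).mpr hc
    rw [uIoc_of_le (by linarith [Real.pi_pos]), show -π + 2 * π = π by ring] at hθ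
    exact log_circleMap hR hθ
  have h2 := (hper.intervalIntegrable_iff (t₁ := -π) (t₂ := 0)).mp h1
  simpa [CircleIntegrable] using h2

/-- **The circle part of the keyhole integral, in closed form**: for `|w| < R`,
`∮_{|z|=R} dz log z/(z − w) = 2πi log(R + w)` (principal branch on both sides).  Proof as printed — *"Hence the
integral above can be written as a sum of two integrals"*: expand `(z − w)⁻¹ = Σ wⁿ z^{−n−1}` on the circle
(Mathlib's Cauchy power series of a circle-integrable function), integrate termwise with §1, and resum the
logarithmic series `log R + Σ_{n≥1}(−1)^{n+1}(w/R)ⁿ/n = log(R + w)`. [cite: Balaban1985UV3, (63) p.272] -/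
theorem circleIntegral_sub_inv_mul_log {R : ℝ} (hR : 0 < R) {w : ℂ} (hw : ‖w‖ < R) :
    (∮ z in C(0, R), (z - w)⁻¹ * Complex.log z) = 2 * π * I * Complex.log (R + w) := by
  have H := hasSum_two_pi_I_cauchyPowerSeries_integral (circleIntegrable_log hR) hw
  simp only [sub_zero, zero_add, smul_eq_mul] at H
  have hwR : ‖w / R‖ < 1 := by
    rw [norm_div, Complex.norm_real, Real.norm_eq_abs, abs_of_pos hR, div_lt_one hR]
    exact hw
  have hne : (1 : ℂ) + w / R ≠ 0 := by
    intro h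
    have h' : w / R = -1 := by linear_combination h
    rw [h', norm_neg, norm_one] at hwR
    exact lt_irrefl _ hwR
  have G := ((Complex.hasSum_taylorSeries_log hwR).mul_left (2 * π * I)).add
    (hasSum_ite_eq 0 (2 * π * I * (Real.log R : ℂ)))
  have hterm : (fun n : ℕ => ∮ z in C(0, R), (w / z) ^ n * (z⁻¹ * Complex.log z))
      = fun n : ℕ => 2 * π * I * ((-1) ^ (n + 1) * (w / R) ^ n / n)
          + (if n = 0 then 2 * π * I * (Real.log R : ℂ) else 0) := by
    funext n
    have hrw : (fun z : ℂ => (w / z) ^ n * (z⁻¹ * Complex.log z))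
        = fun z : ℂ => w ^ n * ((z ^ (n + 1))⁻¹ * Complex.log z) := by
      funext z
      rw [div_eq_mul_inv, mul_pow, pow_succ, mul_inv, inv_pow]
      ring
    rw [hrw, circleIntegral.integral_const_mul]
    rcases eq_or_ne n 0 with rfl | hn
    · simp [circleIntegral_inv_mul_log hR]
    · rw [circleIntegral_inv_pow_mul_log hR hn, if_neg hn, div_pow]
      have hn' : (n : ℂ) ≠ 0 := Nat.cast_ne_zero.mpr hn
      have hR' : (R : ℂ) ≠ 0 := ofReal_ne_zero.mpr hR.ne'
      have hRn : (R : ℂ) ^ n ≠ 0 := pow_ne_zero _ hR'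
      field_simp
      ring
  rw [hterm] at H
  rw [H.unique G, ← mul_add, add_comm, ← Complex.log_ofReal_mul hR hne]
  have hR' : (R : ℂ) ≠ 0 := ofReal_ne_zero.mpr hR.ne'
  have harg : (R : ℂ) * (1 + w / R) = R + w := by
    field_simp
  rw [harg]

end cauchy

/-! ## §3. The keyhole contour `C`: the circle `|z| = R` and the two edges of the cut `[−R, 0]` -/

section keyhole

/-- The integral of `log z · g(z) dz` along the UPPER edge of the cut, from `−R` to `0` (parametrised `z = −x`,
`x` from `R` down to `0`, `dz = −dx`): `∫₀^R log₊(−x) g(−x) dx` with the boundary value from `Im z > 0`,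
`log₊(−x) = log x + iπ` — which IS the principal value `Complex.log (−x)` (the principal branch is continuous from
above on the negative axis, `upper_boundary_value`).  p. 271: *"the two intervals [−2γ₁, 0]* ⟦printed [2γ₁, 0]⟧
*with opposite orientations"*. [cite: Balaban1985UV3, (63) p.271] -/
def cutUpper (R : ℝ) (g : ℂ → ℂ) : ℂ :=
  ∫ x in (0 : ℝ)..R, Complex.log (-(x : ℂ)) * g (-(x : ℂ))

/-- The integral of `log z · g(z) dz` along the LOWER edge of the cut, from `0` to `−R` (parametrised `z = −x`, `x`
from `0` to `R`, `dz = −dx`): `−∫₀^R log₋(−x) g(−x) dx` with the boundary value from `Im z < 0`,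
`log₋(−x) = log x − iπ` (the limit of the principal `log` from below, `lower_boundary_value`).
[cite: Balaban1985UV3, (63) p.271] -/
def cutLower (R : ℝ) (g : ℂ → ℂ) : ℂ :=
  -∫ x in (0 : ℝ)..R, ((Real.log x : ℂ) - π * I) * g (-(x : ℂ))

/-- **The keyhole contour integral `∮_C dz log z · g(z)`** of p. 271: `C` = the circle `|z| = R` (positively
oriented) ∪ the two edges of the cut `[−R, 0]` of `log` with opposite orientations (the boundary of the slit disc
`{|z| < R} ∖ [−R, 0]`, on which the principal `log` is holomorphic). [cite: Balaban1985UV3, (63) p.271] -/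
def keyholeIntegral (R : ℝ) (g : ℂ → ℂ) : ℂ :=
  (∮ z in C(0, R), Complex.log z * g z) + cutUpper R g + cutLower R g

/-- The principal value at a negative real: `log(−x) = log x + iπ`, `x > 0`. [folklore] -/
private theorem log_neg_ofReal {x : ℝ} (hx : 0 < x) : Complex.log (-(x : ℂ)) = Real.log x + π * I := by
  rw [show (-(x : ℂ)) = x * (-1 : ℂ) by ring, Complex.log_ofReal_mul hx (by norm_num), Complex.log_neg_one]

/-- The upper boundary value: the principal `log` is continuous from `Im z ≥ 0` at `−x`, `x > 0` (Mathlib).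
[folklore] -/
private theorem upper_boundary_value {x : ℝ} (hx : 0 < x) :
    ContinuousWithinAt Complex.log {z : ℂ | 0 ≤ z.im} (-(x : ℂ)) :=
  Complex.continuousWithinAt_log_of_re_neg_of_im_zero (by simp [hx]) (by simp)

/-- The lower boundary value: the principal `log` tends to `log x − iπ` at `−x`, `x > 0`, from `Im z < 0` (Mathlib).
[folklore] -/
private theorem lower_boundary_value {x : ℝ} (hx : 0 < x) :
    Tendsto Complex.log (𝓝[{z : ℂ | z.im < 0}] (-(x : ℂ))) (𝓝 ((Real.log x : ℂ) - π * I)) := by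
  have h := Complex.tendsto_log_nhdsWithin_im_neg_of_re_neg_of_im_zero (z := -(x : ℂ)) (by simp [hx]) (by simp)
  have hn : ‖(-(x : ℂ))‖ = x := by rw [norm_neg, Complex.norm_real, Real.norm_eq_abs, abs_of_pos hx]
  rwa [hn] at h

/-- `x ↦ log x` (real, cast to `ℂ`) is interval integrable. [folklore] -/
private theorem intervalIntegrable_ofReal_log (a b : ℝ) :
    IntervalIntegrable (fun x : ℝ => ((Real.log x : ℝ) : ℂ)) volume a b := by
  have h := intervalIntegral.intervalIntegrable_log' (a := a) (b := b)
  rw [intervalIntegrable_iff] at h ⊢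
  exact Complex.ofRealCLM.integrable_comp h

/-- **The two edges of the cut add up to `2πi∫₀^R g(−x)dx`**: the boundary values of `log` differ by the constant
`2πi` across the cut (*"Hence the integral above can be written as a sum of two integrals"*); `g` continuous on the
cut suffices. [cite: Balaban1985UV3, (63) p.272] -/
theorem cutUpper_add_cutLower {R : ℝ} (hR : 0 ≤ R) {g : ℂ → ℂ}
    (hg : ContinuousOn (fun x : ℝ => g (-(x : ℂ))) (Set.Icc 0 R)) :
    cutUpper R g + cutLower R g = 2 * π * I * ∫ x in (0 : ℝ)..R, g (-(x : ℂ)) := by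
  have hlogi := intervalIntegrable_ofReal_log 0 R
  have hg' : ContinuousOn (fun x : ℝ => g (-(x : ℂ))) (Set.uIcc 0 R) := by rwa [uIcc_of_le hR]
  have hi2 : IntervalIntegrable (fun x : ℝ => ((Real.log x : ℂ) - π * I) * g (-(x : ℂ))) volume 0 R :=
    (hlogi.sub intervalIntegrable_const).mul_continuousOn hg'
  have hi1' : IntervalIntegrable (fun x : ℝ => ((Real.log x : ℂ) + π * I) * g (-(x : ℂ))) volume 0 R :=
    (hlogi.add intervalIntegrable_const).mul_continuousOn hg'
  have hi1 : IntervalIntegrable (fun x : ℝ => Complex.log (-(x : ℂ)) * g (-(x : ℂ))) volume 0 R := by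
    refine (intervalIntegrable_congr fun x hx => ?_).mpr hi1'
    rw [uIoc_of_le hR] at hx
    simp only [log_neg_ofReal hx.1]
  rw [cutUpper, cutLower, ← sub_eq_add_neg, ← intervalIntegral.integral_sub hi1 hi2,
    ← intervalIntegral.integral_const_mul]
  refine intervalIntegral.integral_congr_ae (ae_of_all _ fun x hx => ?_)
  rw [uIoc_of_le hR] at hx
  rw [log_neg_ofReal hx.1]
  ring

end keyhole

/-! ## §4. One eigenvalue: `−(1/4πi)∮_C dz log z (z − λ)⁻¹ = ½ log λ⁻¹` -/

section scalar

/-- **The keyhole integral for one eigenvalue** `0 < λ < R`: `∮_C dz log z (z − λ)⁻¹ = 2πi log λ` — circle part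
`2πi log(R + λ)` (§2) plus cut part `2πi∫₀^R(−x − λ)⁻¹dx = −2πi(log(R + λ) − log λ)` (§3): the `log(R + λ)`
cancel (the residue theorem on the slit disc, computed by hand). [cite: Balaban1985UV3, (63) pp.271–272] -/
theorem keyhole_sub_inv {lam R : ℝ} (hlam : 0 < lam) (hR : lam < R) :
    keyholeIntegral R (fun z => (z - lam)⁻¹) = 2 * π * I * Real.log lam := by
  have hR0 : 0 < R := hlam.trans hR
  have hcirc : (∮ z in C(0, R), Complex.log z * (z - lam)⁻¹) = 2 * π * I * (Real.log (R + lam) : ℂ) := by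
    have hw : ‖(lam : ℂ)‖ < R := by
      rw [Complex.norm_real, Real.norm_eq_abs, abs_of_pos hlam]; exact hR
    have h := circleIntegral_sub_inv_mul_log hR0 hw
    have hfun : (fun z : ℂ => Complex.log z * (z - lam)⁻¹) = fun z : ℂ => (z - lam)⁻¹ * Complex.log z := by
      funext z; ring
    rw [hfun, h, ← ofReal_add, ← Complex.ofReal_log (by positivity)]
  have hcont : ContinuousOn (fun x : ℝ => ((-(x : ℂ)) - lam)⁻¹) (Set.Icc 0 R) := by
    refine ContinuousOn.inv₀ (by fun_prop) fun x hx h => ?_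
    have h' := congrArg Complex.re h
    simp at h'
    linarith [hx.1]
  have hcut := cutUpper_add_cutLower (g := fun z : ℂ => (z - lam)⁻¹) hR0.le hcont
  have hint : (∫ x in (0 : ℝ)..R, ((-(x : ℂ)) - lam)⁻¹) = -((Real.log (R + lam) - Real.log lam : ℝ) : ℂ) := by
    have h1 : (fun x : ℝ => ((-(x : ℂ)) - lam)⁻¹) = fun x : ℝ => ((-(x + lam)⁻¹ : ℝ) : ℂ) := by
      funext x
      rw [show (-(x : ℂ)) - lam = -((x : ℂ) + lam) by ring, inv_neg]
      push_cast
      ring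
    rw [h1, intervalIntegral.integral_ofReal, intervalIntegral.integral_neg,
      B10LogDet63.integral_inv_add hlam hR0.le]
    push_cast
    ring
  rw [keyholeIntegral, add_assoc, hcut, hcirc, hint]
  push_cast
  ring

/-- **(63), one eigenvalue, contour form**: `−(1/4πi)∮_C dz log z (z − λ)⁻¹ = −½ log λ = ½ log λ⁻¹` for
`0 < λ < R` (in the paper `R = 2γ₁ ≥ 2λ`). [cite: Balaban1985UV3, (63) p.271] -/
theorem scalar63_contour {lam R : ℝ} (hlam : 0 < lam) (hR : lam < R) :
    -(1 / (4 * π * I)) * keyholeIntegral R (fun z => (z - lam)⁻¹) = ((-(1 / 2) * Real.log lam : ℝ) : ℂ) := by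
  rw [keyhole_sub_inv hlam hR]
  have hπ : (π : ℂ) ≠ 0 := ofReal_ne_zero.mpr Real.pi_ne_zero
  push_cast
  field_simp
  ring

end scalar


/-! ## §5. Operator level: `½ log det T⁻¹ = −½ Tr log T = −(1/4πi)∮_C dz log z Tr(zI − T)⁻¹`, (63) line 1 -/

section matrix

variable {n : Type*} [Fintype n] [DecidableEq n] {T : Matrix n n ℝ}

omit [DecidableEq n] in
/-- Complexification commutes with products. [folklore] -/
private theorem map_mul_ofReal (A B : Matrix n n ℝ) :
    (A * B).map ((↑) : ℝ → ℂ) = A.map ((↑) : ℝ → ℂ) * B.map ((↑) : ℝ → ℂ) :=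
  Matrix.map_mul (f := Complex.ofRealHom)

omit [Fintype n] [DecidableEq n] in
/-- Complexification commutes with `star` (transpose ↦ conjugate transpose of a real matrix). [folklore] -/
private theorem star_map_ofReal (U : Matrix n n ℝ) : star (U.map ((↑) : ℝ → ℂ)) = (star U).map ((↑) : ℝ → ℂ) := by
  ext i j
  simp [Matrix.star_apply, Matrix.map_apply]

/-- **`Tr(zI − T)⁻¹ = Σ_k (z − λ_k)⁻¹`** for the complexification of a real symmetric matrix `T`, at every `z ∈ ℂ`
off its spectrum (the resolvent of the printed contour integrand, diagonalised by the orthogonal eigenbasis: a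
function of a Hermitian matrix through its unitary diagonalisation). [cite: HornJohnson2013, §4.1 (Thm 4.1.5)] -/
theorem trace_resolvent_complexify (hT : T.IsHermitian) {z : ℂ} (hz : ∀ k, z ≠ (hT.eigenvalues k : ℂ)) :
    trace ((z • (1 : Matrix n n ℂ) - T.map ((↑) : ℝ → ℂ))⁻¹) = ∑ k, (z - (hT.eigenvalues k : ℂ))⁻¹ := by
  set U : Matrix n n ℝ := (hT.eigenvectorUnitary : Matrix n n ℝ) with hUdef
  have hU : U * star U = 1 := Matrix.mem_unitaryGroup_iff.mp hT.eigenvectorUnitary.2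
  have hU' : star U * U = 1 := Matrix.mem_unitaryGroup_iff'.mp hT.eigenvectorUnitary.2
  have hspec : T = U * diagonal hT.eigenvalues * star U := by
    have h := hT.spectral_theorem
    rw [Unitary.conjStarAlgAut_apply] at h
    simpa using h
  set Uc : Matrix n n ℂ := U.map ((↑) : ℝ → ℂ) with hUc
  have h01 : (1 : Matrix n n ℝ).map ((↑) : ℝ → ℂ) = 1 := Matrix.map_one _ ofReal_zero ofReal_one
  have hUc1 : Uc * star Uc = 1 := by rw [hUc, star_map_ofReal, ← map_mul_ofReal, hU, h01]
  have hUc2 : star Uc * Uc = 1 := by rw [hUc, star_map_ofReal, ← map_mul_ofReal, hU', h01]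
  have hTc : T.map ((↑) : ℝ → ℂ) = Uc * diagonal (fun k => (hT.eigenvalues k : ℂ)) * star Uc := by
    conv_lhs => rw [hspec]
    rw [map_mul_ofReal, map_mul_ofReal, star_map_ofReal, diagonal_map ofReal_zero]
  have hzI : z • (1 : Matrix n n ℂ) = Uc * Matrix.diagonal (fun _ => z) * star Uc := by
    rw [← smul_one_eq_diagonal, Matrix.mul_smul, Matrix.mul_one, Matrix.smul_mul, hUc1]
  have hres : z • (1 : Matrix n n ℂ) - T.map ((↑) : ℝ → ℂ)
      = Uc * diagonal (fun k => z - (hT.eigenvalues k : ℂ)) * star Uc := by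
    rw [hzI, hTc, ← Matrix.sub_mul, ← Matrix.mul_sub, diagonal_sub]
  have hDinv : (diagonal (fun k => z - (hT.eigenvalues k : ℂ)))⁻¹
      = diagonal (fun k => (z - (hT.eigenvalues k : ℂ))⁻¹) := by
    apply Matrix.inv_eq_right_inv
    rw [diagonal_mul_diagonal, ← diagonal_one]
    congr 1
    funext k
    exact mul_inv_cancel₀ (sub_ne_zero.mpr (hz k))
  rw [hres, Matrix.mul_inv_rev, Matrix.mul_inv_rev, Matrix.inv_eq_left_inv hUc1, Matrix.inv_eq_left_inv hUc2,
    hDinv, Matrix.trace_mul_comm, Matrix.mul_assoc, hUc2, Matrix.mul_one, trace_diagonal]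

/-- The contour integrand of p. 271 at operator level: `z ↦ Tr(zI − T)⁻¹` for the complexified real matrix `T`
(*"Tr(zI − C*Δ_kC)⁻¹"*). [cite: Balaban1985UV3, (63) p.271] -/
def resolventTrace (T : Matrix n n ℝ) (z : ℂ) : ℂ :=
  trace ((z • (1 : Matrix n n ℂ) - T.map ((↑) : ℝ → ℂ))⁻¹)

/-- On the cut: `Tr((−x)I − T)⁻¹ = −Tr(xI + T)⁻¹` for `x ≥ 0`, `T ≻ 0` — the integrand of the first term of (63).
[folklore] -/
private theorem resolventTrace_neg (hT : T.PosDef) {x : ℝ} (hx : 0 ≤ x) :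
    resolventTrace T (-(x : ℂ)) = -((trace ((x • (1 : Matrix n n ℝ) + T)⁻¹) : ℝ) : ℂ) := by
  have hev : ∀ k, 0 < hT.1.eigenvalues k := hT.eigenvalues_pos
  have hz : ∀ k, (-(x : ℂ)) ≠ (hT.1.eigenvalues k : ℂ) := by
    intro k h
    have h' := congrArg Complex.re h
    simp at h'
    linarith [hev k]
  rw [resolventTrace, trace_resolvent_complexify hT.1 hz, B10LogDet63.trace_resolvent_eq_sum hT hx]
  push_cast
  rw [← Finset.sum_neg_distrib]
  refine Finset.sum_congr rfl fun k _ => ?_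
  rw [show (-(x : ℂ)) - (hT.1.eigenvalues k : ℂ) = -((x : ℂ) + hT.1.eigenvalues k) by ring, inv_neg]

/-- On the circle `|z| = R` with `R > λ_k` for all `k`, `T ≻ 0`: `Tr(zI − T)⁻¹ = Σ_k (z − λ_k)⁻¹`. [folklore] -/
private theorem resolventTrace_sphere (hT : T.PosDef) {R : ℝ} (hR : ∀ k, hT.1.eigenvalues k < R) {z : ℂ}
    (hz : z ∈ Metric.sphere (0 : ℂ) R) : resolventTrace T z = ∑ k, (z - (hT.1.eigenvalues k : ℂ))⁻¹ := by
  refine trace_resolvent_complexify hT.1 fun k h => ?_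
  have h1 : ‖z‖ = R := by simpa using hz
  rw [h, Complex.norm_real, Real.norm_eq_abs, abs_of_pos (hT.eigenvalues_pos k)] at h1
  linarith [hR k]

omit [DecidableEq n] in
/-- Swapping a finite sum of pole terms with the circle integral of `log`. [folklore] -/
private theorem circleIntegral_sum_sub_inv_mul_log {R : ℝ} (hR0 : 0 < R) (w : n → ℂ) (hw : ∀ k, ‖w k‖ < R) :
    (∮ z in C(0, R), ∑ k, (z - w k)⁻¹ * Complex.log z) = ∑ k, ∮ z in C(0, R), (z - w k)⁻¹ * Complex.log z := by
  simp only [circleIntegral, Finset.smul_sum]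
  refine intervalIntegral.integral_finsetSum fun k _ => ?_
  have hlog : IntervalIntegrable (fun θ : ℝ => Complex.log (circleMap 0 R θ)) volume 0 (2 * π) :=
    circleIntegrable_log hR0
  have hc1 : Continuous (fun θ : ℝ => deriv (circleMap 0 R) θ) := by
    simp only [deriv_circleMap]
    exact (continuous_circleMap 0 R).mul continuous_const
  have hc2 : ContinuousOn (fun θ : ℝ => (circleMap 0 R θ - w k)⁻¹) (Set.uIcc 0 (2 * π)) := by
    refine ContinuousOn.inv₀ ((continuous_circleMap 0 R).continuousOn.sub continuousOn_const) fun θ _ h => ?_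
    have h1 : ‖circleMap 0 R θ‖ = R := by simpa using circleMap_mem_sphere (0 : ℂ) hR0.le θ
    rw [sub_eq_zero.mp h] at h1
    linarith [hw k]
  convert hlog.continuousOn_mul (hc1.continuousOn.mul hc2) using 1
  funext θ
  simp only [smul_eq_mul, Pi.mul_apply]
  ring

/-- **The circle part at operator level**: `∮_{|z|=R} dz log z Tr(zI − T)⁻¹ = 2πi Σ_k log(R + λ_k)` for `T ≻ 0`
with all eigenvalues `< R`. [cite: Balaban1985UV3, (63) p.272] -/
theorem circle_part (hT : T.PosDef) {R : ℝ} (hR0 : 0 < R) (hR : ∀ k, hT.1.eigenvalues k < R) :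
    (∮ z in C(0, R), Complex.log z * resolventTrace T z)
      = 2 * π * I * ∑ k, (Real.log (R + hT.1.eigenvalues k) : ℂ) := by
  have hev : ∀ k, 0 < hT.1.eigenvalues k := hT.eigenvalues_pos
  have hw : ∀ k, ‖(hT.1.eigenvalues k : ℂ)‖ < R := fun k => by
    rw [Complex.norm_real, Real.norm_eq_abs, abs_of_pos (hev k)]; exact hR k
  have hEq : Set.EqOn (fun z : ℂ => Complex.log z * resolventTrace T z)
      (fun z : ℂ => ∑ k, (z - (hT.1.eigenvalues k : ℂ))⁻¹ * Complex.log z) (Metric.sphere (0 : ℂ) R) := by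
    intro z hz
    simp only [resolventTrace_sphere hT hR hz, Finset.mul_sum]
    exact Finset.sum_congr rfl fun k _ => mul_comm _ _
  rw [circleIntegral.integral_congr hR0.le hEq, circleIntegral_sum_sub_inv_mul_log hR0 _ hw, Finset.mul_sum]
  refine Finset.sum_congr rfl fun k _ => ?_
  rw [circleIntegral_sub_inv_mul_log hR0 (hw k), ← ofReal_add,
    ← Complex.ofReal_log (by linarith [hev k] : (0 : ℝ) ≤ R + hT.1.eigenvalues k)]

/-- **The cut part at operator level**: the two edges of the cut give `−2πi∫₀^R dx Tr(xI + T)⁻¹`, i.e. after the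
factor `−1/4πi` the first term `½∫₀^{2γ₁} dx Tr(T + xI)⁻¹` of (63). [cite: Balaban1985UV3, (63) p.272] -/
theorem cut_part (hT : T.PosDef) {R : ℝ} (hR0 : 0 ≤ R) :
    cutUpper R (resolventTrace T) + cutLower R (resolventTrace T)
      = -(2 * π * I) * ((∫ x in (0 : ℝ)..R, trace ((x • (1 : Matrix n n ℝ) + T)⁻¹) : ℝ) : ℂ) := by
  have hev : ∀ k, 0 < hT.1.eigenvalues k := hT.eigenvalues_pos
  have hcont : ContinuousOn (fun x : ℝ => resolventTrace T (-(x : ℂ))) (Set.Icc 0 R) := by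
    have hg : ContinuousOn (fun x : ℝ => -(((∑ k, (x + hT.1.eigenvalues k)⁻¹ : ℝ)) : ℂ)) (Set.Icc 0 R) := by
      refine (Complex.continuous_ofReal.comp_continuousOn ?_).neg
      refine continuousOn_finsetSum _ fun k _ => ContinuousOn.inv₀ (by fun_prop) fun x hx => ?_
      exact (add_pos_of_nonneg_of_pos hx.1 (hev k)).ne'
    refine hg.congr fun x hx => ?_
    rw [resolventTrace_neg hT hx.1, B10LogDet63.trace_resolvent_eq_sum hT hx.1]
  rw [cutUpper_add_cutLower hR0 hcont]
  have hint : (∫ x in (0 : ℝ)..R, resolventTrace T (-(x : ℂ)))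
      = -(((∫ x in (0 : ℝ)..R, trace ((x • (1 : Matrix n n ℝ) + T)⁻¹) : ℝ)) : ℂ) := by
    rw [intervalIntegral.integral_congr (g := fun x : ℝ => -((trace ((x • (1 : Matrix n n ℝ) + T)⁻¹) : ℝ) : ℂ))
      (fun x hx => ?_)]
    · rw [intervalIntegral.integral_neg, intervalIntegral.integral_ofReal]
    · rw [Set.uIcc_of_le hR0] at hx
      exact resolventTrace_neg hT hx.1
  rw [hint]
  ring

/-- **(63), the contour representation at operator level**: for a positive definite real symmetric `T` with every
eigenvalue `≤ γ₁` (*"The number γ₁ is an upper bound of the positive, bounded operator"*) and the keyhole contour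
`C` of radius `2γ₁`:  `−(1/4πi)∮_C dz log z Tr(zI − T)⁻¹ = −½ log det T = ½ log det T⁻¹`.
[cite: Balaban1985UV3, (63) p.271] -/
theorem matrix63_contour (hT : T.PosDef) {γ₁ : ℝ} (hγ₁ : 0 < γ₁) (hγ : ∀ k, hT.1.eigenvalues k ≤ γ₁) :
    -(1 / (4 * π * I)) * keyholeIntegral (2 * γ₁) (resolventTrace T) = ((-(1 / 2) * Real.log T.det : ℝ) : ℂ) := by
  have hev : ∀ k, 0 < hT.1.eigenvalues k := hT.eigenvalues_pos
  have hR0 : 0 < 2 * γ₁ := by positivity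
  have hR : ∀ k, hT.1.eigenvalues k < 2 * γ₁ := fun k => by linarith [hγ k, hev k]
  rw [keyholeIntegral, add_assoc, cut_part hT hR0.le, circle_part hT hR0 hR,
    B10LogDet63.integral_trace_resolvent hT hR0.le, B10LogDet63.log_det_eq_sum hT]
  have hπ : (π : ℂ) ≠ 0 := ofReal_ne_zero.mpr Real.pi_ne_zero
  have hI : I ≠ 0 := Complex.I_ne_zero
  push_cast
  simp only [Finset.sum_sub_distrib]
  field_simp
  ring

/-- **The three printed members of the p. 271 display agree** (finite-dimensional model, `R = 2γ₁`):
`½ log det T⁻¹ = −½ Tr log T` (with `log T = cfc log T` the matrix function) and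
`−½ Tr log T = −(1/4πi)∮_C dz log z Tr(zI − T)⁻¹`. [cite: Balaban1985UV3, (63) p.271] -/
theorem matrix63_members (hT : T.PosDef) {γ₁ : ℝ} (hγ₁ : 0 < γ₁) (hγ : ∀ k, hT.1.eigenvalues k ≤ γ₁) :
    (1 / 2) * Real.log T.det⁻¹ = -(1 / 2) * trace (cfc Real.log T)
    ∧ ((-(1 / 2) * trace (cfc Real.log T) : ℝ) : ℂ) = -(1 / (4 * π * I)) * keyholeIntegral (2 * γ₁) (resolventTrace T) := by
  have htr : trace (cfc Real.log T) = Real.log T.det := by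
    rw [Literature.LinearAlgebra.Matrix.trace_cfc_eq_sum_eigenvalues hT.1, B10LogDet63.log_det_eq_sum hT]
    simp
  refine ⟨?_, ?_⟩
  · rw [Real.log_inv, htr]; ring
  · rw [matrix63_contour hT hγ₁ hγ, htr]

/-- **(63) line 1, the termwise expansion of the circle part**: on `|z| = R > λ_k`,
`∮_{|z|=R} dz log z Tr(zI − T)⁻¹ = Σ_{n≥0} (∮_{|z|=R} dz log z z^{−n−1}) Tr Tⁿ` as a convergent series
(the geometric expansion of the resolvent, eigenvalue by eigenvalue, via Mathlib's Cauchy power series of the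
circle-integrable `log`). [cite: Balaban1985UV3, (63) p.272] -/
theorem hasSum_circle_expansion (hT : T.PosDef) {R : ℝ} (hR0 : 0 < R) (hR : ∀ k, hT.1.eigenvalues k < R) :
    HasSum (fun m : ℕ => (∮ z in C(0, R), (z ^ (m + 1))⁻¹ * Complex.log z) * ((trace (T ^ m) : ℝ) : ℂ))
      (∮ z in C(0, R), Complex.log z * resolventTrace T z) := by
  have hev : ∀ k, 0 < hT.1.eigenvalues k := hT.eigenvalues_pos
  have hw : ∀ k, ‖(hT.1.eigenvalues k : ℂ)‖ < R := fun k => by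
    rw [Complex.norm_real, Real.norm_eq_abs, abs_of_pos (hev k)]; exact hR k
  have hk : ∀ k, HasSum (fun m : ℕ => (∮ z in C(0, R), (z ^ (m + 1))⁻¹ * Complex.log z)
      * (hT.1.eigenvalues k : ℂ) ^ m) (∮ z in C(0, R), (z - (hT.1.eigenvalues k : ℂ))⁻¹ * Complex.log z) := by
    intro k
    have H := hasSum_two_pi_I_cauchyPowerSeries_integral (circleIntegrable_log hR0) (hw k)
    simp only [sub_zero, zero_add, smul_eq_mul] at H
    have hterm : (fun m : ℕ => ∮ z in C(0, R), ((hT.1.eigenvalues k : ℂ) / z) ^ m * (z⁻¹ * Complex.log z))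
        = fun m : ℕ => (∮ z in C(0, R), (z ^ (m + 1))⁻¹ * Complex.log z) * (hT.1.eigenvalues k : ℂ) ^ m := by
      funext m
      have hrw : (fun z : ℂ => ((hT.1.eigenvalues k : ℂ) / z) ^ m * (z⁻¹ * Complex.log z))
          = fun z : ℂ => (hT.1.eigenvalues k : ℂ) ^ m * ((z ^ (m + 1))⁻¹ * Complex.log z) := by
        funext z
        rw [div_eq_mul_inv, mul_pow, pow_succ, mul_inv, inv_pow]
        ring
      rw [hrw, circleIntegral.integral_const_mul, mul_comm]
    rw [hterm] at H
    exact H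
  have hs := hasSum_sum (s := Finset.univ) fun k _ => hk k
  have hEq : Set.EqOn (fun z : ℂ => Complex.log z * resolventTrace T z)
      (fun z : ℂ => ∑ k, (z - (hT.1.eigenvalues k : ℂ))⁻¹ * Complex.log z) (Metric.sphere (0 : ℂ) R) := by
    intro z hz
    simp only [resolventTrace_sphere hT hR hz, Finset.mul_sum]
    exact Finset.sum_congr rfl fun k _ => mul_comm _ _
  rw [circleIntegral.integral_congr hR0.le hEq, circleIntegral_sum_sub_inv_mul_log hR0 _ hw]
  convert hs using 1
  funext m
  rw [B10LogDet63.trace_pow_eq_sum hT.1 m]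
  push_cast
  rw [Finset.mul_sum]

/-- **(63), from line 1 to line 2 — the circle terms evaluated**: with `R = 2γ₁`,
`Σ_{n≥0} (1/4πi)(∮_{|z|=2γ₁} dz log z z^{−n−1}) Tr Tⁿ = ½ log(2γ₁)·Tr I − Σ_{n≥1}((−1)ⁿ/2n)(2γ₁)⁻ⁿ Tr Tⁿ`
(the `n = 0` term is the constant ⟦printed `−½C*Δ_kC`⟧; the `n ≥ 1` terms by §1; convergence of the tail is the
cell's `…B10LogDet63.hasSum_matrix63`). [cite: Balaban1985UV3, (63) p.272] -/
theorem hasSum_circle_terms (hT : T.PosDef) {γ₁ : ℝ} (hγ₁ : 0 < γ₁) (hγ : ∀ k, hT.1.eigenvalues k ≤ γ₁) :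
    HasSum (fun m : ℕ => 1 / (4 * π * I) * (∮ z in C(0, 2 * γ₁), (z ^ (m + 1))⁻¹ * Complex.log z)
        * ((trace (T ^ m) : ℝ) : ℂ))
      ((((1 / 2) * (Fintype.card n : ℝ) * Real.log (2 * γ₁)
        - ∑' j : ℕ, (-1) ^ (j + 1) / (2 * ((j : ℝ) + 1)) * ((2 * γ₁) ^ (j + 1))⁻¹ * trace (T ^ (j + 1)) : ℝ)) : ℂ) := by
  have hR0 : 0 < 2 * γ₁ := by positivity
  have hπ : (π : ℂ) ≠ 0 := ofReal_ne_zero.mpr Real.pi_ne_zero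
  have hI : I ≠ 0 := Complex.I_ne_zero
  have hR' : ((2 * γ₁ : ℝ) : ℂ) ≠ 0 := ofReal_ne_zero.mpr hR0.ne'
  set f : ℕ → ℝ := fun j => (-1) ^ (j + 1) / (2 * ((j : ℝ) + 1)) * ((2 * γ₁) ^ (j + 1))⁻¹ * trace (T ^ (j + 1))
    with hf
  have hreal : HasSum f (∑' j, f j) := (B10LogDet63.hasSum_matrix63 hT hγ₁ hγ).summable.hasSum
  have hcx : HasSum (fun j : ℕ => ((f j : ℝ) : ℂ)) ((∑' j, f j : ℝ) : ℂ) := Complex.hasSum_ofReal.mpr hreal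
  have hfun : (fun j : ℕ => 1 / (4 * π * I)
      * (∮ z in C(0, 2 * γ₁), (z ^ (j + 1 + 1))⁻¹ * Complex.log z) * ((trace (T ^ (j + 1)) : ℝ) : ℂ))
      = fun j : ℕ => -((f j : ℝ) : ℂ) := by
    funext j
    rw [circleIntegral_inv_pow_mul_log hR0 (Nat.succ_ne_zero j), hf]
    have hj : ((j : ℂ) + 1) ≠ 0 := Nat.cast_add_one_ne_zero j
    push_cast
    field_simp
    ring
  have htail : HasSum (fun j : ℕ => 1 / (4 * π * I)
      * (∮ z in C(0, 2 * γ₁), (z ^ (j + 1 + 1))⁻¹ * Complex.log z) * ((trace (T ^ (j + 1)) : ℝ) : ℂ))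
      (-(((∑' j, f j : ℝ)) : ℂ)) := by
    rw [hfun]
    exact hcx.neg
  have h0 : 1 / (4 * π * I) * (∮ z in C(0, 2 * γ₁), (z ^ (0 + 1))⁻¹ * Complex.log z) * ((trace (T ^ 0) : ℝ) : ℂ)
      = (((1 / 2) * (Fintype.card n : ℝ) * Real.log (2 * γ₁) : ℝ) : ℂ) := by
    simp only [zero_add, pow_one, pow_zero, Matrix.trace_one]
    rw [circleIntegral_inv_mul_log hR0]
    push_cast
    field_simp
    ring
  have h := (hasSum_nat_add_iff (f := fun m : ℕ => 1 / (4 * π * I)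
      * (∮ z in C(0, 2 * γ₁), (z ^ (m + 1))⁻¹ * Complex.log z) * ((trace (T ^ m) : ℝ) : ℂ)) 1).mp htail
  simp only [Finset.sum_range_one] at h
  rw [h0] at h
  have hv : ((((1 / 2) * (Fintype.card n : ℝ) * Real.log (2 * γ₁) - ∑' j : ℕ, f j : ℝ)) : ℂ)
      = -(((∑' j, f j : ℝ)) : ℂ) + (((1 / 2) * (Fintype.card n : ℝ) * Real.log (2 * γ₁) : ℝ) : ℂ) := by
    push_cast
    ring
  rw [hv]
  exact h

/-- **(63) line 1 at operator level**: `−(1/4πi)∮_C dz log z Tr(zI − T)⁻¹ =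
½∫₀^{2γ₁} dx Tr(T + xI)⁻¹ − Σ_{n≥0} (1/4πi)(∮_{|z|=2γ₁} dz log z z^{−n−1}) Tr Tⁿ`.
[cite: Balaban1985UV3, (63) p.272] -/
theorem matrix63_line1 (hT : T.PosDef) {γ₁ : ℝ} (hγ₁ : 0 < γ₁) (hγ : ∀ k, hT.1.eigenvalues k ≤ γ₁) :
    -(1 / (4 * π * I)) * keyholeIntegral (2 * γ₁) (resolventTrace T)
      = (((1 / 2) * ∫ x in (0 : ℝ)..(2 * γ₁), trace ((x • (1 : Matrix n n ℝ) + T)⁻¹) : ℝ) : ℂ)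
        - ∑' m : ℕ, 1 / (4 * π * I) * (∮ z in C(0, 2 * γ₁), (z ^ (m + 1))⁻¹ * Complex.log z)
          * ((trace (T ^ m) : ℝ) : ℂ) := by
  have hev : ∀ k, 0 < hT.1.eigenvalues k := hT.eigenvalues_pos
  have hR0 : 0 < 2 * γ₁ := by positivity
  have hR : ∀ k, hT.1.eigenvalues k < 2 * γ₁ := fun k => by linarith [hγ k, hev k]
  have hπ : (π : ℂ) ≠ 0 := ofReal_ne_zero.mpr Real.pi_ne_zero
  have hI : I ≠ 0 := Complex.I_ne_zero
  have hts : ∑' m : ℕ, 1 / (4 * π * I) * (∮ z in C(0, 2 * γ₁), (z ^ (m + 1))⁻¹ * Complex.log z)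
      * ((trace (T ^ m) : ℝ) : ℂ)
      = 1 / (4 * π * I) * ∮ z in C(0, 2 * γ₁), Complex.log z * resolventTrace T z := by
    rw [← (hasSum_circle_expansion hT hR0 hR).tsum_eq, ← tsum_mul_left]
    refine tsum_congr fun m => ?_
    ring
  rw [hts, keyholeIntegral, add_assoc, cut_part hT hR0.le]
  push_cast
  field_simp
  ring

/-- **(63) line 1 = line 2**: the right-hand side of `matrix63_line1` equals the three-piece splitting
`½∫₀^{2γ₁} dx Tr(T + xI)⁻¹ − ½ log(2γ₁)·Tr I + Σ_{n≥1}((−1)ⁿ/2n)(2γ₁)⁻ⁿ Tr Tⁿ` — the right-hand side of the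
cell's `…B10LogDet63.matrix63` (which certifies that it equals `−½ log det T` by the real-variable route; here the
same value is reached along the printed contour route, `matrix63_contour`). [cite: Balaban1985UV3, (63) p.272] -/
theorem matrix63_line1_eq_line2 (hT : T.PosDef) {γ₁ : ℝ} (hγ₁ : 0 < γ₁) (hγ : ∀ k, hT.1.eigenvalues k ≤ γ₁) :
    (((1 / 2) * ∫ x in (0 : ℝ)..(2 * γ₁), trace ((x • (1 : Matrix n n ℝ) + T)⁻¹) : ℝ) : ℂ)
        - ∑' m : ℕ, 1 / (4 * π * I) * (∮ z in C(0, 2 * γ₁), (z ^ (m + 1))⁻¹ * Complex.log z)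
          * ((trace (T ^ m) : ℝ) : ℂ)
      = (((1 / 2) * (∫ x in (0 : ℝ)..(2 * γ₁), trace ((x • (1 : Matrix n n ℝ) + T)⁻¹))
          - (1 / 2) * (Fintype.card n : ℝ) * Real.log (2 * γ₁)
          + ∑' j : ℕ, (-1) ^ (j + 1) / (2 * ((j : ℝ) + 1)) * ((2 * γ₁) ^ (j + 1))⁻¹ * trace (T ^ (j + 1)) : ℝ) : ℂ) := by
  rw [(hasSum_circle_terms hT hγ₁ hγ).tsum_eq]
  push_cast
  ring

end matrix

end Literature.MathematicalPhysics.QuantumFieldTheory.Balaban1983to89.B10Eq63Contour
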